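import Summits.HodgeConjecture.HodgeConjecture.Theorems.GenericDivisibilityGenericDivisibilityBoundedHeartDescent
import Summits.HodgeConjecture.HodgeConjecture.Theorems.GenericDivisibilityGenericDivisibilityBoundedLevelCleanFunnel
import HarnessLib

/-!
# The heart of line `finite-level-bootstrap` (crux C2 `GenericDivisibilityBounded`,
# stmt-HodgeConjecture-18467) descends along surjective morphisms of ANY nonzero degree

Registered sub-goal `stub_heartOfHasDegree` (lead c6, cycle 8). Sorry-free, definition-free.
`X'`, `X` are smooth projective over `ℂ` of the same dimension `n`, `f : X' ⟶ X` a `ℂ`-morphism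
onto on points, `f(ℂ) = AlgPoints.mapContinuous f : X'(ℂ) → X(ℂ)`, `μ`, `ν` INTEGRAL orientations
of the closed `2n`-manifolds `X'(ℂ)`, `X(ℂ)`, `f` of degree `ℓ^v d'` for them
(`f(ℂ)_* [X'(ℂ)]_μ = (ℓ^v d') • [X(ℂ)]_ν`, `HasDegree`) with `gcd(ℓ, d') = 1`, `ℓ ≥ 1`, and
`f_! = gysinMap μ ν f(ℂ) : H^k(X'(ℂ);ℤ) → H^k(X(ℂ);ℤ)` (`k + q = 2n`) the integral Gysin map
(Fulton, Young Tableaux App. B (5)). As in the sibling files `…HeartDescent`, `…LevelCleanFunnel`,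
spelled inline: `z| = z|_{(X∖Z)(ℂ)}`; "`x ∈ GT(X)`" (generically torsion): `∃ Z` closed `≠ univ`,
`∃ N ≥ 1`, `N • x| = 0`; "`D'(m, z)`": `∃ Z` closed `≠ univ`, `∃ y`, `∃ M ≥ 1`,
`M • (z| - m • y) = 0`; "level `ℓ^s` is CLEAN at `X`" (the heart `stub_finiteLevel` at one `X`):
`∀ z, D'(ℓ^s, z) → ∃ w, z - ℓ • w ∈ GT(X)`.

## Main results

* `genericDivisibilityBounded_pow_mul_smul_sub` — the piece of algebra
  `(ℓ^v d) • z - ℓ^(v+1) • g = ℓ^v • (d • z - ℓ • g)`.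
* `genericDivisibilityBounded_levelClean_of_hasDegree_pow` — **the heart DESCENDS along `f` onto of
  degree `ℓ^v d'`, `gcd(ℓ, d') = 1`, with level shift `v`**: level `ℓ^s` clean at `X'` in degree
  `k ≥ 1` implies level `ℓ^(v+s)` clean at `X` in degree `k`. Route:
  `D'(ℓ^(v+s), z) ⇒ D'(ℓ^(v+s), f^*z)` (`genericDivisibilityBounded_levelDivisible_map`); the
  BOOTSTRAP at `X'` (`genericDivisibilityBounded_bootstrap`, `n = v`) gives
  `f^*z - ℓ^(v+1) • w' ∈ GT(X')`; push forward by the integral Gysin map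
  (`genericDivisibilityBounded_gysinMap_genericallyTorsion`, `f_! f^* = deg`,
  `gysinMap_map_of_hasDegree`): `ℓ^v • (d' • z - ℓ • f_! w') = (ℓ^v d') • z - ℓ^(v+1) • f_! w' ∈
  GT(X)`; `GT` is SATURATED (`genericDivisibilityBounded_genericallyTorsion_of_nsmul`), so
  `d' • z - ℓ • f_! w' ∈ GT(X)`; Bézout `a ℓ + b d' = 1`:
  `z - ℓ • (a • z + b • f_! w') = b • (d' • z - ℓ • f_! w') ∈ GT(X)`
  (`genericDivisibilityBounded_bezout_smul`).
* `stub_heartOfHasDegree` — the registered signature, verbatim (`n = k = q = 2p`, `p ≥ 1`). The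
  case `v = 0` is the landed `stub_heartOfHasDegreeCoprime` (p162684).

References: [FultonYoungTableaux1997] App. B §B.1 (5)–(7); [VoisinHodgeII2003] §9.2.4
Prop. 9.21 (ii); [HatcherAT2002] §3.1, §3.3 Thm. 3.30; [ColliotTheleneVoisin2012] §3.
-/

set_option linter.dupNamespace false

noncomputable section

namespace Summit.HodgeConjecture.HodgeConjecture.Theorems

open CategoryTheory AlgebraicGeometry
open Literature.AlgebraicGeometry.Motives Literature.AlgebraicGeometry.HodgeTheory
  Literature.AlgebraicTopology.SingularHomology

/-- Restriction `H^k(X(ℂ);ℤ) → H^k((X∖Z)(ℂ);ℤ)`, the very term of the route decls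
(notation only). -/
local notation3 (prettyPrint := false) "Res[" X ", " Z ", " k "]" =>
  singularCohomology.map ℤ ℤ
    (⟨Subtype.val, continuous_subtype_val⟩ : C(complexPointsCompl X Z, ComplexPoints X)) k

/-! ### A piece of algebra -/

/-- In an abelian group, `(ℓ^v d) • z - ℓ^(v+1) • g = ℓ^v • (d • z - ℓ • g)` (`ℓ, v ∈ ℕ`,
`d ∈ ℤ`). [folklore] -/
theorem genericDivisibilityBounded_pow_mul_smul_sub {M : Type*} [AddCommGroup M] (ℓ v : ℕ)
    (d : ℤ) (z g : M) :
    ((ℓ : ℤ) ^ v * d) • z - ℓ ^ (v + 1) • g = ℓ ^ v • (d • z - ℓ • g) := by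
  module

/-! ### The heart descends along surjective morphisms of degree `ℓ^v d'`, `gcd(ℓ, d') = 1` -/

/-- **The heart descends along `f : X' ⟶ X` onto, of degree `ℓ^v d'` with `gcd(ℓ, d') = 1`, at the
price of a level shift by `v`.** Let `X'`, `X` be smooth projective of dimension `n`, `f` onto on
points, of degree `ℓ^v d'` for integral orientations `μ`, `ν`
(`f(ℂ)_*[X'(ℂ)]_μ = (ℓ^v d') • [X(ℂ)]_ν`), `k + q = 2n`, `k ≥ 1`, `ℓ ≥ 1`, `gcd(ℓ, d') = 1`. If
level `ℓ^s` is clean at `X'` in degree `k` then level `ℓ^(v+s)` is clean at `X` in degree `k`: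
given `D'(ℓ^(v+s), z)`, `D'(ℓ^(v+s), f^*z)` (`genericDivisibilityBounded_levelDivisible_map`), so
the bootstrap at `X'` (`genericDivisibilityBounded_bootstrap` with `n = v`) gives
`f^*z - ℓ^(v+1) • w' ∈ GT(X')` for some `w'`; push forward:
`f_!(f^*z - ℓ^(v+1) • w') = (ℓ^v d') • z - ℓ^(v+1) • f_! w' = ℓ^v • (d' • z - ℓ • f_! w') ∈ GT(X)`
(`f_! f^* z = deg • z`, Fulton App. B (6)–(7), `gysinMap_map_of_hasDegree` with Poincaré duality
`poincare_duality`; `f_!(GT(X')) ⊆ GT(X)`,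
`genericDivisibilityBounded_gysinMap_genericallyTorsion`, Voisin II Prop. 9.21 (ii)); `GT(X)` is
saturated (`genericDivisibilityBounded_genericallyTorsion_of_nsmul`), so
`d' • z - ℓ • f_! w' ∈ GT(X)`; with `a ℓ + b d' = 1`, `w := a • z + b • f_! w'` has
`z - ℓ • w = b • (d' • z - ℓ • f_! w') ∈ GT(X)`.
[cite: FultonYoungTableaux1997, Appendix B §B.1 (5)–(7)]
[cite: VoisinHodgeII2003, §9.2.4 Prop. 9.21 (ii)] -/
theorem genericDivisibilityBounded_levelClean_of_hasDegree_pow {n : ℕ} {X' X : SchemeOver ℂ}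
    (f : X' ⟶ X) (hX' : IsSmoothProjective n X') (hX : IsSmoothProjective n X)
    (μ : HomologicalOrientation ℤ (ComplexPoints X') (2 * n))
    (ν : HomologicalOrientation ℤ (ComplexPoints X) (2 * n)) {ℓ v : ℕ} {d' : ℤ}
    (hdeg : HasDegree μ ν (AlgPoints.mapContinuous (L := ℂ) f) ((ℓ : ℤ) ^ v * d'))
    (hf : Function.Surjective f.left.base) {k q : ℕ} (hkq : k + q = 2 * n) (hk : 1 ≤ k)
    (hℓ : 1 ≤ ℓ) (hℓd : IsCoprime (ℓ : ℤ) d') (s : ℕ)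
    (hC : ∀ z' : singularCohomology ℤ ℤ (ComplexPoints X') k,
      (∃ Z : Set X'.left, IsClosed Z ∧ Z ≠ Set.univ ∧
        ∃ (y : singularCohomology ℤ ℤ (complexPointsCompl X' Z) k) (M : ℕ), 1 ≤ M ∧
          M • (Res[X', Z, k] z' - ℓ ^ s • y) = 0) →
      ∃ w : singularCohomology ℤ ℤ (ComplexPoints X') k, ∃ Z : Set X'.left, IsClosed Z ∧
        Z ≠ Set.univ ∧ ∃ N : ℕ, 1 ≤ N ∧ N • Res[X', Z, k] (z' - ℓ • w) = 0)
    (z : singularCohomology ℤ ℤ (ComplexPoints X) k)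
    (hz : ∃ Z : Set X.left, IsClosed Z ∧ Z ≠ Set.univ ∧
      ∃ (y : singularCohomology ℤ ℤ (complexPointsCompl X Z) k) (M : ℕ), 1 ≤ M ∧
        M • (Res[X, Z, k] z - ℓ ^ (v + s) • y) = 0) :
    ∃ w : singularCohomology ℤ ℤ (ComplexPoints X) k, ∃ Z : Set X.left, IsClosed Z ∧
      Z ≠ Set.univ ∧ ∃ N : ℕ, 1 ≤ N ∧ N • Res[X, Z, k] (z - ℓ • w) = 0 := by
  -- Poincaré duality for `ν` over `ℤ` (Hatcher Thm. 3.30, proved in the tree)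
  have hν : ν.HasPoincareDuality := fun _ _ h' ↦
    ComplexPoints.bijective_poincareDualityMap_of (fun ν' _ _ h'' ↦ poincare_duality ν' h'') hX ν h'
  -- the bootstrap at `X'` for `f^* z`: `f^* z - ℓ^(v+1) • w' ∈ GT(X')`
  obtain ⟨w', hw'⟩ := genericDivisibilityBounded_bootstrap hX' k ℓ s hℓ hC v _
    (genericDivisibilityBounded_levelDivisible_map f hf (ℓ ^ (v + s)) hz)
  -- push forward: `ℓ^v • (d' • z - ℓ • f_! w') = (ℓ^v d') • z - ℓ^(v+1) • f_! w' ∈ GT(X)`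
  have hGT := genericDivisibilityBounded_gysinMap_genericallyTorsion hX' hX f μ ν hkq hkq le_rfl hk
    hk hw'
  rw [map_sub, map_nsmul, gysinMap_map_of_hasDegree hν hdeg hkq z,
    genericDivisibilityBounded_pow_mul_smul_sub] at hGT
  -- saturation: `d' • z - ℓ • f_! w' ∈ GT(X)`
  replace hGT := genericDivisibilityBounded_genericallyTorsion_of_nsmul (Nat.one_le_pow _ _ hℓ) hGT
  -- Bézout
  obtain ⟨a, b, hab⟩ := hℓd
  refine ⟨a • z + b • gysinMap μ ν (AlgPoints.mapContinuous (L := ℂ) f) hkq hkq w', ?_⟩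
  rw [genericDivisibilityBounded_bezout_smul hab]
  exact genericDivisibilityBounded_genericallyTorsion_zsmul b hGT

/-! ### The registered sub-goal -/

/-- **Registered sub-goal `stub_heartOfHasDegree` of stmt-HodgeConjecture-18467 (lead c6, cycle 8,
line `finite-level-bootstrap`): the heart DESCENDS along surjective morphisms of ANY nonzero
degree, with level shift the `ℓ`-adic valuation of the degree.** For `f : X' ⟶ X` onto between
smooth projective `2p`-folds (`p ≥ 1`), of degree `ℓ^v d'` for integral orientations `μ`, `ν` of
`X'(ℂ)`, `X(ℂ)`, `ℓ ≥ 1`, `gcd(ℓ, d') = 1`: level `ℓ^s` clean at `X'` implies level `ℓ^(v+s)`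
clean at `X` (proof: `genericDivisibilityBounded_levelClean_of_hasDegree_pow` at `n = k = q = 2p`
— pull back `D'(ℓ^(v+s), z)`, bootstrap at `X'`, push forward by the integral Gysin map,
`f_! f^* = ℓ^v d'`, `f_!(GT) ⊆ GT`, saturation of `GT`, Bézout). This removes the coprimality
hypothesis of `stub_heartOfHasDegreeCoprime` (p162684, the case `v = 0`): since the heart is
`∃ s`, the heart at `ℓ` descends along EVERY surjection of nonzero degree between smooth
projective `2p`-folds. Statement: the skeleton's, verbatim.
[cite: FultonYoungTableaux1997, Appendix B §B.1 (5)–(7)]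
[cite: VoisinHodgeII2003, §9.2.4 Prop. 9.21 (ii)] -/
theorem stub_heartOfHasDegree :
    ∀ ⦃p : ℕ⦄ ⦃X' X : SchemeOver ℂ⦄ (f : X' ⟶ X)
      (μ : HomologicalOrientation ℤ (ComplexPoints X') (2 * (2 * p)))
      (ν : HomologicalOrientation ℤ (ComplexPoints X) (2 * (2 * p))) (ℓ v : ℕ) (d' : ℤ),
      1 ≤ p → IsSmoothProjective (2 * p) X' → IsSmoothProjective (2 * p) X →
      HasDegree μ ν (AlgPoints.mapContinuous f) ((ℓ : ℤ) ^ v * d') → Function.Surjective f.left.base →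
      1 ≤ ℓ → IsCoprime (ℓ : ℤ) d' → ∀ s : ℕ,
      (∀ z' : singularCohomology ℤ ℤ (ComplexPoints X') (2 * p),
        (∃ Z : Set X'.left, IsClosed Z ∧ Z ≠ Set.univ ∧
          ∃ (y : singularCohomology ℤ ℤ (complexPointsCompl X' Z) (2 * p)) (M : ℕ), 1 ≤ M ∧
            M • (singularCohomology.map ℤ ℤ
              (⟨Subtype.val, continuous_subtype_val⟩ : C(complexPointsCompl X' Z, ComplexPoints X'))
              (2 * p) z' - ℓ ^ s • y) = 0) →
        ∃ w : singularCohomology ℤ ℤ (ComplexPoints X') (2 * p),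
          ∃ Z : Set X'.left, IsClosed Z ∧ Z ≠ Set.univ ∧ ∃ N : ℕ, 1 ≤ N ∧
            N • singularCohomology.map ℤ ℤ
              (⟨Subtype.val, continuous_subtype_val⟩ : C(complexPointsCompl X' Z, ComplexPoints X'))
              (2 * p) (z' - ℓ • w) = 0) →
      ∀ z : singularCohomology ℤ ℤ (ComplexPoints X) (2 * p),
        (∃ Z : Set X.left, IsClosed Z ∧ Z ≠ Set.univ ∧
          ∃ (y : singularCohomology ℤ ℤ (complexPointsCompl X Z) (2 * p)) (M : ℕ), 1 ≤ M ∧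
            M • (singularCohomology.map ℤ ℤ
              (⟨Subtype.val, continuous_subtype_val⟩ : C(complexPointsCompl X Z, ComplexPoints X))
              (2 * p) z - ℓ ^ (v + s) • y) = 0) →
        ∃ w : singularCohomology ℤ ℤ (ComplexPoints X) (2 * p),
          ∃ Z : Set X.left, IsClosed Z ∧ Z ≠ Set.univ ∧ ∃ N : ℕ, 1 ≤ N ∧
            N • singularCohomology.map ℤ ℤ
              (⟨Subtype.val, continuous_subtype_val⟩ : C(complexPointsCompl X Z, ComplexPoints X))
              (2 * p) (z - ℓ • w) = 0 :=
  fun p _ _ f μ ν _ _ _ hp hX' hX hdeg hf hℓ hℓd s hC z hz ↦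
    genericDivisibilityBounded_levelClean_of_hasDegree_pow f hX' hX μ ν hdeg hf (q := 2 * p)
      (by omega) (by omega) hℓ hℓd s hC z hz

end Summit.HodgeConjecture.HodgeConjecture.Theorems

end
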